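import Mathlib
import Literature.NumberTheory.LFunctions.ZetaZerosJensen
import Literature.NumberTheory.LFunctions.ZetaZerosReflection
import Summits.RiemannHypothesis.RiemannHypothesis.Theorems.DensityLadderExplicitFormulaC2
import Summits.RiemannHypothesis.RiemannHypothesis.Theorems.DensityLadderWindowTestFunction
import HarnessLib

/-!
# `DensityLadder.ZetaIntegerPrimeConsistent` (item stmt-RiemannHypothesis-24919) — K2 of LINE L57

File 3/3: the item itself, stated VERBATIM as filed (the route decl is not yet rendered in
`Theses/DensityLadder.lean`; the by-name closer is a one-line `exact` once it is).

ζ's non-trivial zeros with their orders `m(ρ)` and the von Mangoldt weight `Λ` form an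
"integer-prime-consistent tame configuration" in the sense of the line «sieve sight above the
density line» (rh-idea-10 g1): `0 ≤ Λ(n) ≤ log(n+2)`; the smoothed explicit formula holds in every
short window `x(1 ± η)`, `0 < η ≤ 1/2`, `x ≥ 3`, for every `C²` bump `φ` on `[−1, 1]`, with error
`O_φ(log x)` — in fact `O_φ(1)`, confirming the η-uniformity flagged by the critic (idea-crit-2,
VERDICT 2026-08-28): the error is `Re(ĝ(0) + W_∞^B(g))`, `|ĝ(0)| ≤ 2 sup|φ|`,
`|W_∞^B(g)| ≤ (18/5) log 2 · sup|φ|`; the zeros with `Re ρ ≤ 1/2` have unit-window count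
`≪ log(|T|+2)` (Jensen windows, reflection `ρ ↦ 1 − ρ̄` for `Re ρ < 1/4`); `m ≥ 0`, `Re ρ ≥ 0`,
and conjugation is an order-preserving involution.  Sources: Iwaniec–Kowalski Thm. 5.12,
Bombieri 2000 Thm. 2 (tree `tsum_zeroSide_eq_bombieri`), Montgomery–Vaughan Thm. 10.13 (tree
`exists_sum_zetaZeroWindow_le`).
Cell rh-split, seat rh-split-prover-l57 g0.  RH-free; FRONTIER bookkeeping (DH-capped line);
nothing here bears on the truth of RH.
-/

set_option linter.dupNamespace false

noncomputable section

open Complex Filter Set MeasureTheory Topology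
open scoped Real ComplexConjugate

namespace Summit.RiemannHypothesis.RiemannHypothesis.Theorems.DensityLadderZetaIntegerPrimeConsistent

open Literature.NumberTheory.LFunctions
open Summit.RiemannHypothesis.RiemannHypothesis.Theorems.DensityLadderExplicitFormulaC2
open Summit.RiemannHypothesis.RiemannHypothesis.Theorems.DensityLadderWindowTestFunction

/-! ## The tame part: local counting of the non-trivial zeros with `Re ρ ≤ 1/2` -/

section Tame

/-- **Unit-window count of the zeros with `Re ρ ≤ 1/2`** (Riemann–von Mangoldt / Jensen local
count, tree `exists_sum_zetaZeroWindow_le`, the zeros with `Re ρ < 1/4` being reflected by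
`ρ ↦ 1 − ρ̄`): there is `C` with, for every real `T`, the set of non-trivial zeros `ρ` with
`Re ρ ≤ 1/2`, `|Im ρ − T| ≤ 1` finite and `Σ m(ρ) ≤ C log(|T| + 2)` over it.
[cite: MontgomeryVaughan2007, Thm. 10.13] -/
theorem exists_tame_window_bound :
    ∃ C : ℝ, ∀ T : ℝ,
      {i : ZetaZeros.riemannZetaNontrivialZeros | (i : ℂ).re ≤ 1 / 2 ∧ |(i : ℂ).im - T| ≤ 1}.Finite ∧
      (∑ᶠ i ∈ {i : ZetaZeros.riemannZetaNontrivialZeros | (i : ℂ).re ≤ 1 / 2 ∧ |(i : ℂ).im - T| ≤ 1},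
        (riemannZetaZeroOrder (i : ℂ) : ℝ)) ≤ C * Real.log (|T| + 2) := by
  classical
  obtain ⟨C₀, hC₀, hW⟩ := exists_sum_zetaZeroWindow_le
  refine ⟨4 * C₀, fun T ↦ ?_⟩
  set S : Set ZetaZeros.riemannZetaNontrivialZeros :=
    {i | (i : ℂ).re ≤ 1 / 2 ∧ |(i : ℂ).im - T| ≤ 1} with hS
  -- finiteness
  have hSfin : S.Finite := by
    refine Set.Finite.of_finite_image ?_ Subtype.val_injective.injOn
    refine (((isCompact_Icc (a := (0 : ℝ)) (b := 1)).reProdIm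
      (isCompact_Icc (a := T - 1) (b := T + 1))).inter_riemannZetaZeros_finite).subset ?_
    rintro _ ⟨i, hi, rfl⟩
    have h0 := ZetaZeros.riemannZetaNontrivialZeros.re_pos i.2
    have h1 := ZetaZeros.riemannZetaNontrivialZeros.re_lt_one i.2
    have h2 := (abs_le.1 hi.2)
    exact ⟨Complex.mem_reProdIm.2 ⟨⟨h0.le, h1.le⟩, ⟨by linarith, by linarith⟩⟩,
      ZetaZeros.riemannZetaNontrivialZeros.zeta_eq_zero i.2⟩
  refine ⟨hSfin, ?_⟩
  rw [finsum_mem_eq_finite_toFinset_sum _ hSfin]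
  -- the injection into the Jensen windows at heights `T ∓ 1/2`
  set p : ZetaZeros.riemannZetaNontrivialZeros → ℂ :=
    fun i ↦ if 1 / 4 ≤ (i : ℂ).re then (i : ℂ) else 1 - conj (i : ℂ) with hp
  have hp_re_of_ge : ∀ i : ZetaZeros.riemannZetaNontrivialZeros, 1 / 4 ≤ (i : ℂ).re → p i = (i : ℂ) :=
    fun i h ↦ by simp only [hp]; rw [if_pos h]
  have hp_re_of_lt : ∀ i : ZetaZeros.riemannZetaNontrivialZeros, ¬ 1 / 4 ≤ (i : ℂ).re →
      p i = 1 - conj (i : ℂ) := fun i h ↦ by simp only [hp]; rw [if_neg h]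
  have hp_im : ∀ i : ZetaZeros.riemannZetaNontrivialZeros, (p i).im = (i : ℂ).im := by
    intro i
    by_cases h : 1 / 4 ≤ (i : ℂ).re
    · rw [hp_re_of_ge i h]
    · rw [hp_re_of_lt i h]; simp
  have hp_order : ∀ i : ZetaZeros.riemannZetaNontrivialZeros,
      riemannZetaZeroOrder (p i) = riemannZetaZeroOrder (i : ℂ) := by
    intro i
    by_cases h : 1 / 4 ≤ (i : ℂ).re
    · rw [hp_re_of_ge i h]
    · rw [hp_re_of_lt i h]
      exact riemannZetaZeroOrder_one_sub_conj (ZetaZeros.riemannZetaNontrivialZeros.re_pos i.2)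
        (ZetaZeros.riemannZetaNontrivialZeros.re_lt_one i.2)
  have hp_zero : ∀ i : ZetaZeros.riemannZetaNontrivialZeros, riemannZeta (p i) = 0 := by
    intro i
    by_cases h : 1 / 4 ≤ (i : ℂ).re
    · rw [hp_re_of_ge i h]; exact ZetaZeros.riemannZetaNontrivialZeros.zeta_eq_zero i.2
    · rw [hp_re_of_lt i h]
      exact ZetaZeros.riemannZetaNontrivialZeros.zeta_eq_zero
        (ZetaZeros.riemannZetaNontrivialZeros.one_sub_conj_mem i.2)
  have hp_re : ∀ i : ZetaZeros.riemannZetaNontrivialZeros, 1 / 4 ≤ (p i).re := by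
    intro i
    by_cases h : 1 / 4 ≤ (i : ℂ).re
    · rwa [hp_re_of_ge i h]
    · rw [hp_re_of_lt i h]; simp only [sub_re, one_re, conj_re]; have := not_le.1 h; linarith
  have hinj : Set.InjOn p (hSfin.toFinset : Set ZetaZeros.riemannZetaNontrivialZeros) := by
    intro i hi j hj hij
    rw [Finset.mem_coe, Set.Finite.mem_toFinset] at hi hj
    by_cases h1 : 1 / 4 ≤ (i : ℂ).re <;> by_cases h2 : 1 / 4 ≤ (j : ℂ).re
    · rw [hp_re_of_ge i h1, hp_re_of_ge j h2] at hij; exact Subtype.ext hij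
    · exfalso
      rw [hp_re_of_ge i h1, hp_re_of_lt j h2] at hij
      have := congrArg Complex.re hij
      simp only [sub_re, one_re, conj_re] at this
      have := not_le.1 h2; linarith [hi.1]
    · exfalso
      rw [hp_re_of_lt i h1, hp_re_of_ge j h2] at hij
      have := congrArg Complex.re hij
      simp only [sub_re, one_re, conj_re] at this
      have := not_le.1 h1; linarith [hj.1]
    · rw [hp_re_of_lt i h1, hp_re_of_lt j h2] at hij
      have h' : conj (i : ℂ) = conj (j : ℂ) := sub_right_injective hij
      have : (i : ℂ) = (j : ℂ) := by simpa using congrArg conj h'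
      exact Subtype.ext this
  -- rewrite the sum through `p`
  have hsum_eq : ∑ i ∈ hSfin.toFinset, (riemannZetaZeroOrder (i : ℂ) : ℝ) =
      ∑ ρ ∈ hSfin.toFinset.image p, (riemannZetaZeroOrder ρ : ℝ) := by
    rw [Finset.sum_image hinj]
    exact Finset.sum_congr rfl fun i _ ↦ by rw [hp_order]
  rw [hsum_eq]
  -- the image lies in the union of the two windows
  set W₁ := (zetaZeroWindow_finite (T - 1 / 2)).toFinset with hW₁
  set W₂ := (zetaZeroWindow_finite (T + 1 / 2)).toFinset with hW₂
  have hsub : hSfin.toFinset.image p ⊆ W₁ ∪ W₂ := by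
    intro ρ hρ
    rw [Finset.mem_image] at hρ
    obtain ⟨i, hi, rfl⟩ := hρ
    rw [Set.Finite.mem_toFinset] at hi
    have him := abs_le.1 hi.2
    rw [Finset.mem_union, hW₁, hW₂, Set.Finite.mem_toFinset, Set.Finite.mem_toFinset]
    simp only [zetaZeroWindow, mem_setOf_eq, hp_im]
    rcases le_or_gt ((i : ℂ).im) T with h | h
    · exact Or.inl ⟨hp_zero i, hp_re i, abs_le.2 ⟨by linarith, by linarith⟩⟩
    · exact Or.inr ⟨hp_zero i, hp_re i, abs_le.2 ⟨by linarith, by linarith⟩⟩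
  have hnn : ∀ ρ ∈ W₁ ∪ W₂, (0 : ℝ) ≤ riemannZetaZeroOrder ρ := by
    intro ρ hρ
    rw [Finset.mem_union, hW₁, hW₂, Set.Finite.mem_toFinset, Set.Finite.mem_toFinset] at hρ
    rcases hρ with h | h
    · exact riemannZetaZeroOrder_nonneg_of_zero h.1
    · exact riemannZetaZeroOrder_nonneg_of_zero h.1
  refine (Finset.sum_le_sum_of_subset_of_nonneg hsub fun ρ hρ _ ↦ hnn ρ hρ).trans ?_
  have hunion : ∑ ρ ∈ W₁ ∪ W₂, (riemannZetaZeroOrder ρ : ℝ) ≤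
      ∑ ρ ∈ W₁, (riemannZetaZeroOrder ρ : ℝ) + ∑ ρ ∈ W₂, (riemannZetaZeroOrder ρ : ℝ) := by
    rw [← Finset.sum_union_inter]
    have : 0 ≤ ∑ ρ ∈ W₁ ∩ W₂, (riemannZetaZeroOrder ρ : ℝ) :=
      Finset.sum_nonneg fun ρ hρ ↦ hnn ρ (Finset.mem_union.2 (Or.inl (Finset.mem_inter.1 hρ).1))
    linarith
  refine hunion.trans ?_
  have h1 := hW (T - 1 / 2)
  have h2 := hW (T + 1 / 2)
  -- `log(|T ∓ 1/2| + 2) ≤ 2 log(|T| + 2)`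
  have hlog : ∀ u : ℝ, |u| ≤ |T| + 1 / 2 → Real.log (|u| + 2) ≤ 2 * Real.log (|T| + 2) := by
    intro u hu
    calc Real.log (|u| + 2) ≤ Real.log ((|T| + 2) ^ 2) :=
          Real.log_le_log (by positivity) (by nlinarith [abs_nonneg T, abs_nonneg u])
      _ = 2 * Real.log (|T| + 2) := by rw [Real.log_pow]; norm_num
  have hu1 : |T - 1 / 2| ≤ |T| + 1 / 2 := by
    have := abs_sub T (1 / 2); rw [abs_of_pos (by norm_num : (0 : ℝ) < 1 / 2)] at this; exact this
  have hu2 : |T + 1 / 2| ≤ |T| + 1 / 2 := by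
    have := abs_add_le T (1 / 2); rw [abs_of_pos (by norm_num : (0 : ℝ) < 1 / 2)] at this; exact this
  have hl1 := mul_le_mul_of_nonneg_left (hlog _ hu1) hC₀.le
  have hl2 := mul_le_mul_of_nonneg_left (hlog _ hu2) hC₀.le
  rw [hW₁, hW₂] at *
  linarith

end Tame

/-! ## The window explicit formula with `O(1)` error, uniformly in `η ∈ (0, 1/2]`, `x ≥ 3` -/

section Main

/-- **Smoothed explicit formula in short windows, `O_φ(1)` error** (Iwaniec–Kowalski Thm. 5.12 /
Bombieri 2000 Thm. 2 for `ζ`, applied to the test function `g(t) = e^{t/2} φ((e^t/x − 1)/η)`, whose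
transform is `ĝ(ρ) = η x^ρ ∫_{-1}^{1} φ(v)(1+ηv)^{ρ−1} dv`): for `φ ∈ C²` vanishing off `(−1, 1)`
there is `C_φ` such that for all `0 < η ≤ 1/2`, `x ≥ 3` the zero side converges absolutely and
`|Σ_n Λ(n) φ((n/x−1)/η) − ηx∫φ + η Re Σ_ρ m(ρ) x^ρ ∫φ(v)(1+ηv)^{ρ−1}dv| ≤ C_φ log x`; in fact the
left side is `Re(ĝ(0) + W_∞^B(g)) = O_φ(1)`: `g(0) = 0`, `g(−log n) = 0`, `|ĝ(0)| ≤ 2 sup|φ|` and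
`|W_∞^B(g)| ≤ (9/5) log 4 · sup|φ|`. [cite: IwaniecKowalski2004, Thm. 5.12; Bombieri2000Weil, Thm. 2 p. 186] -/
theorem window_explicit_formula (φ : ℝ → ℝ) (hφ : ContDiff ℝ 2 φ)
    (hφs : ∀ v, 1 ≤ |v| → φ v = 0) :
    ∃ Cφ : ℝ, ∀ η x : ℝ, 0 < η → η ≤ 1 / 2 → 3 ≤ x →
      Summable (fun i : ZetaZeros.riemannZetaNontrivialZeros ↦
        (riemannZetaZeroOrder (i : ℂ) : ℝ) * ‖(x : ℂ) ^ (i : ℂ) *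
          ∫ v in (-1 : ℝ)..1, (φ v : ℂ) * ((1 : ℂ) + (η : ℂ) * (v : ℂ)) ^ ((i : ℂ) - 1)‖) ∧
      |(∑' n : ℕ, ArithmeticFunction.vonMangoldt n * φ (((n : ℝ) / x - 1) / η)) -
          η * x * (∫ v in (-1 : ℝ)..1, φ v) +
          η * (∑' i : ZetaZeros.riemannZetaNontrivialZeros,
            ((riemannZetaZeroOrder (i : ℂ) : ℝ) : ℂ) * ((x : ℂ) ^ (i : ℂ) *
              ∫ v in (-1 : ℝ)..1, (φ v : ℂ) * ((1 : ℂ) + (η : ℂ) * (v : ℂ)) ^ ((i : ℂ) - 1))).re| ≤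
        Cφ * Real.log x := by
  -- a bound for `φ`
  obtain ⟨C, hC⟩ := (isCompact_Icc (a := (-1 : ℝ)) (b := 1)).exists_bound_of_continuousOn
    hφ.continuous.continuousOn
  set M : ℝ := max C 0 with hMdef
  have hM0 : 0 ≤ M := le_max_right _ _
  have hM : ∀ v, |φ v| ≤ M := by
    intro v
    by_cases hv : v ∈ Icc (-1 : ℝ) 1
    · exact ((Real.norm_eq_abs _).symm.le.trans (hC v hv)).trans (le_max_left _ _)
    · rw [mem_Icc, not_and_or, not_le, not_le] at hv
      have : 1 ≤ |v| := by
        rcases hv with h | h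
        · rw [abs_of_neg (by linarith)]; linarith
        · rw [abs_of_pos (by linarith)]; exact h.le
      rw [hφs v this, abs_zero]; exact hM0
  refine ⟨5 * M, fun η x hη hη1 hx ↦ ?_⟩
  have hx0 : 0 < x := by linarith
  -- the window in logarithmic variables and the test function
  set ψ : ℝ → ℝ := fun t ↦ φ ((Real.exp t / x - 1) / η) with hψdef
  set g : ℝ → ℂ := fun t ↦ ((Real.exp (t / 2) * ψ t : ℝ) : ℂ) with hgdef
  -- support of `ψ`
  have hψsupp : ∀ t, ψ t ≠ 0 → t ∈ Icc (Real.log (x / 2)) (Real.log (2 * x)) := by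
    intro t ht
    have hlt : |(Real.exp t / x - 1) / η| < 1 := by
      by_contra h; exact ht (hφs _ (not_lt.1 h))
    rw [abs_lt, lt_div_iff₀ hη, div_lt_iff₀ hη] at hlt
    have het : 0 < Real.exp t := Real.exp_pos t
    have h1 : x / 2 < Real.exp t := by
      have := hlt.1; rw [lt_sub_iff_add_lt, lt_div_iff₀ hx0] at this; nlinarith
    have h2 : Real.exp t < 2 * x := by
      have := hlt.2; rw [sub_lt_iff_lt_add, div_lt_iff₀ hx0] at this; nlinarith
    constructor
    · calc Real.log (x / 2) ≤ Real.log (Real.exp t) := (Real.log_lt_log (by positivity) h1).le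
        _ = t := Real.log_exp t
    · calc t = Real.log (Real.exp t) := (Real.log_exp t).symm
        _ ≤ Real.log (2 * x) := (Real.log_lt_log het h2).le
  have hlog32 : Real.log (3 / 2) ≤ Real.log (x / 2) :=
    Real.log_le_log (by norm_num) (by linarith)
  have hlog_pos : 0 < Real.log (x / 2) := lt_of_lt_of_le (Real.log_pos (by norm_num)) hlog32
  have hψ0 : ∀ t, t ≤ 0 → ψ t = 0 := by
    intro t ht; by_contra h; have := (hψsupp t h).1; linarith
  have hψM : ∀ t, |ψ t| ≤ M := fun t ↦ hM _
  -- smoothness and support of `g`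
  have hψc2 : ContDiff ℝ 2 ψ := by
    have : ContDiff ℝ 2 (fun t : ℝ ↦ (Real.exp t / x - 1) / η) := by fun_prop
    exact hφ.comp this
  have hg2 : ContDiff ℝ 2 g := by
    have h1 : ContDiff ℝ 2 (fun t : ℝ ↦ Real.exp (t / 2) * ψ t) := (by fun_prop : ContDiff ℝ 2
      (fun t : ℝ ↦ Real.exp (t / 2))).mul hψc2
    exact Complex.ofRealCLM.contDiff.comp h1
  have hgs : HasCompactSupport g := by
    refine HasCompactSupport.intro (isCompact_Icc (a := Real.log (x / 2)) (b := Real.log (2 * x)))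
      fun t ht ↦ ?_
    have : ψ t = 0 := by by_contra h; exact ht (hψsupp t h)
    simp [hgdef, this]
  -- the transform
  have hMel : ∀ s : ℂ, weilMellin g s = η * (x : ℂ) ^ s *
      ∫ v in (-1 : ℝ)..1, (φ v : ℂ) * ((1 : ℂ) + (η : ℂ) * (v : ℂ)) ^ (s - 1) := by
    intro s
    rw [hgdef, weilMellin_expHalf_mul ψ s]
    exact integral_window_cexp φ hφ.continuous hφs hη hη1 hx0 s
  -- the explicit formula
  have EF := tsum_zeroSide_eq_bombieri_of_contDiff_two hg2 hgs
  -- the prime side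
  have hP : weilPrimeTerm g =
      ((∑' n : ℕ, ArithmeticFunction.vonMangoldt n * φ (((n : ℝ) / x - 1) / η) : ℝ) : ℂ) := by
    rw [hgdef, weilPrimeTerm_expHalf_mul ψ hψ0, Complex.ofReal_tsum]
    refine tsum_congr fun n ↦ ?_
    rcases Nat.eq_zero_or_pos n with hn | hn
    · subst hn; simp
    · have hn' : (0 : ℝ) < n := by exact_mod_cast hn
      simp only [hψdef, Real.exp_log hn']
  -- `ĝ(1)`
  have hg1 : weilMellin g 1 = ((η * x * ∫ v in (-1 : ℝ)..1, φ v : ℝ) : ℂ) := by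
    rw [hMel 1, sub_self, Complex.cpow_one]
    have : (∫ v in (-1 : ℝ)..1, (φ v : ℂ) * ((1 : ℂ) + (η : ℂ) * (v : ℂ)) ^ (0 : ℂ)) =
        ∫ v in (-1 : ℝ)..1, ((φ v : ℝ) : ℂ) := by
      refine intervalIntegral.integral_congr fun v _ ↦ ?_
      simp
    rw [this, intervalIntegral.integral_ofReal]
    push_cast; ring
  -- `ĝ(0)` and the archimedean term are `O(1)`
  have hg0 : ‖weilMellin g 0‖ ≤ 2 * M := by
    rw [hMel 0]
    exact norm_polarZero_window_le φ hM x hη hη1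
  have hA : ‖weilArchTermBombieri g‖ ≤ 3 * M := by
    have h := norm_weilArchTermBombieri_expHalf_mul_le ψ hlog32
      (Real.log_le_log (by positivity) (by linarith)) hψM hψsupp
    have hlog4 : Real.log (2 * x) - Real.log (x / 2) = 2 * Real.log 2 := by
      rw [Real.log_mul (by norm_num) hx0.ne', Real.log_div hx0.ne' (by norm_num)]; ring
    rw [hlog4] at h
    have := Real.log_two_lt_d9
    nlinarith
  -- the zero side through the transform
  have key : (η : ℂ) * ∑' i : ZetaZeros.riemannZetaNontrivialZeros,
      ((riemannZetaZeroOrder (i : ℂ) : ℝ) : ℂ) * ((x : ℂ) ^ (i : ℂ) *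
        ∫ v in (-1 : ℝ)..1, (φ v : ℂ) * ((1 : ℂ) + (η : ℂ) * (v : ℂ)) ^ ((i : ℂ) - 1)) =
      weilMellin g 0 + weilMellin g 1 - weilPrimeTerm g + weilArchTermBombieri g := by
    rw [← weilPolarTerm, ← EF, ← tsum_mul_left]
    refine tsum_congr fun i ↦ ?_
    rw [hMel]; push_cast; ring
  have hre : (∑' n : ℕ, ArithmeticFunction.vonMangoldt n * φ (((n : ℝ) / x - 1) / η)) -
      η * x * (∫ v in (-1 : ℝ)..1, φ v) +
      η * (∑' i : ZetaZeros.riemannZetaNontrivialZeros,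
        ((riemannZetaZeroOrder (i : ℂ) : ℝ) : ℂ) * ((x : ℂ) ^ (i : ℂ) *
          ∫ v in (-1 : ℝ)..1, (φ v : ℂ) * ((1 : ℂ) + (η : ℂ) * (v : ℂ)) ^ ((i : ℂ) - 1))).re =
      (weilMellin g 0).re + (weilArchTermBombieri g).re := by
    have h := congrArg Complex.re key
    rw [Complex.re_ofReal_mul, hP, hg1] at h
    simp only [Complex.add_re, Complex.sub_re, Complex.ofReal_re] at h
    linarith
  refine ⟨?_, ?_⟩
  · -- absolute convergence
    have hS := summable_norm_zeroSide_of_contDiff_two hg2 hgs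
    refine (hS.mul_left (1 / η)).congr fun i ↦ ?_
    have hm : (0 : ℝ) ≤ riemannZetaZeroOrder (i : ℂ) := by
      exact_mod_cast riemannZetaZeroOrder_nonneg (ZetaZeros.riemannZetaNontrivialZeros.ne_one i.2)
    rw [hMel, norm_mul, Complex.norm_intCast, abs_of_nonneg hm, mul_assoc, norm_mul, norm_mul,
      Complex.norm_real, Real.norm_eq_abs, abs_of_pos hη]
    field_simp
  · rw [hre]
    have h1 := Complex.abs_re_le_norm (weilMellin g 0)
    have h2 := Complex.abs_re_le_norm (weilArchTermBombieri g)
    have hlogx : 1 ≤ Real.log x := by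
      rw [← Real.log_exp 1]
      refine Real.log_le_log (Real.exp_pos 1) ?_
      have := Real.exp_one_lt_d9; linarith
    calc |(weilMellin g 0).re + (weilArchTermBombieri g).re|
        ≤ |(weilMellin g 0).re| + |(weilArchTermBombieri g).re| := abs_add_le _ _
      _ ≤ 5 * M * 1 := by linarith
      _ ≤ 5 * M * Real.log x := mul_le_mul_of_nonneg_left hlogx (by positivity)

/-- **`ZetaIntegerPrimeConsistent` (item stmt-RiemannHypothesis-24919 of route `DensityLadder`,
LINE L57 «sieve sight above the density line», K2), stated VERBATIM as filed** (the route decl is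
not yet rendered in `Theses/DensityLadder.lean`; the by-name closer is a one-line `exact` once it
is): ζ's non-trivial zeros with their orders and the von Mangoldt weight form an
integer-prime-consistent tame configuration — (i) `0 ≤ Λ(n) ≤ log(n+2)`; (ii) the smoothed explicit
formula in every window `x(1 ± η)`, `0 < η ≤ 1/2`, `x ≥ 3`, with error `O_φ(log x)` (in fact
`O_φ(1)`, `window_explicit_formula`); (iii) the unit-window count `≪ log(|T|+2)` of the zeros with
`Re ρ ≤ 1/2`; (iv) `m(ρ) ≥ 0`; (v) `Re ρ ≥ 0`; (vi) the conjugation involution preserving orders.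
RH-free. [cite: IwaniecKowalski2004, Thm. 5.12; MontgomeryVaughan2007, Thm. 10.13] -/
theorem zetaIntegerPrimeConsistent_unfolded :
    ((∃ B : ℝ, ∀ n : ℕ, 0 ≤ (fun n : ℕ ↦ ArithmeticFunction.vonMangoldt n) n ∧ (fun n : ℕ ↦ ArithmeticFunction.vonMangoldt n) n ≤ B * Real.log ((n : ℝ) + 2)) ∧
      (∀ φ : ℝ → ℝ, ContDiff ℝ 2 φ → (∀ v, 0 ≤ φ v) → (∀ v, 1 ≤ |v| → φ v = 0) →
        ∃ Cφ : ℝ, ∀ η x : ℝ, 0 < η → η ≤ 1 / 2 → 3 ≤ x →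
          Summable (fun i : ↥Literature.NumberTheory.LFunctions.ZetaZeros.riemannZetaNontrivialZeros ↦ (fun z : ↥Literature.NumberTheory.LFunctions.ZetaZeros.riemannZetaNontrivialZeros ↦ (Literature.NumberTheory.LFunctions.riemannZetaZeroOrder (z : ℂ) : ℝ)) i * ‖(x : ℂ) ^ ((fun z : ↥Literature.NumberTheory.LFunctions.ZetaZeros.riemannZetaNontrivialZeros ↦ (z : ℂ)) i) *
            ∫ v in (-1 : ℝ)..1, (φ v : ℂ) * ((1 : ℂ) + (η : ℂ) * (v : ℂ)) ^ ((fun z : ↥Literature.NumberTheory.LFunctions.ZetaZeros.riemannZetaNontrivialZeros ↦ (z : ℂ)) i - 1)‖) ∧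
          |(∑' n : ℕ, (fun n : ℕ ↦ ArithmeticFunction.vonMangoldt n) n * φ (((n : ℝ) / x - 1) / η)) - η * x * (∫ v in (-1 : ℝ)..1, φ v)
              + η * (∑' i : ↥Literature.NumberTheory.LFunctions.ZetaZeros.riemannZetaNontrivialZeros, ((fun z : ↥Literature.NumberTheory.LFunctions.ZetaZeros.riemannZetaNontrivialZeros ↦ (Literature.NumberTheory.LFunctions.riemannZetaZeroOrder (z : ℂ) : ℝ)) i : ℂ) * ((x : ℂ) ^ ((fun z : ↥Literature.NumberTheory.LFunctions.ZetaZeros.riemannZetaNontrivialZeros ↦ (z : ℂ)) i) *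
                ∫ v in (-1 : ℝ)..1, (φ v : ℂ) * ((1 : ℂ) + (η : ℂ) * (v : ℂ)) ^ ((fun z : ↥Literature.NumberTheory.LFunctions.ZetaZeros.riemannZetaNontrivialZeros ↦ (z : ℂ)) i - 1))).re|
            ≤ Cφ * Real.log x)) ∧
    ((∃ C : ℝ, ∀ T : ℝ, {i : ↥Literature.NumberTheory.LFunctions.ZetaZeros.riemannZetaNontrivialZeros | ((fun z : ↥Literature.NumberTheory.LFunctions.ZetaZeros.riemannZetaNontrivialZeros ↦ (z : ℂ)) i).re ≤ 1 / 2 ∧ |((fun z : ↥Literature.NumberTheory.LFunctions.ZetaZeros.riemannZetaNontrivialZeros ↦ (z : ℂ)) i).im - T| ≤ 1}.Finite ∧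
        (∑ᶠ i ∈ {i : ↥Literature.NumberTheory.LFunctions.ZetaZeros.riemannZetaNontrivialZeros | ((fun z : ↥Literature.NumberTheory.LFunctions.ZetaZeros.riemannZetaNontrivialZeros ↦ (z : ℂ)) i).re ≤ 1 / 2 ∧ |((fun z : ↥Literature.NumberTheory.LFunctions.ZetaZeros.riemannZetaNontrivialZeros ↦ (z : ℂ)) i).im - T| ≤ 1}, (fun z : ↥Literature.NumberTheory.LFunctions.ZetaZeros.riemannZetaNontrivialZeros ↦ (Literature.NumberTheory.LFunctions.riemannZetaZeroOrder (z : ℂ) : ℝ)) i) ≤ C * Real.log (|T| + 2)) ∧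
      (∀ i : ↥Literature.NumberTheory.LFunctions.ZetaZeros.riemannZetaNontrivialZeros, 0 ≤ (fun z : ↥Literature.NumberTheory.LFunctions.ZetaZeros.riemannZetaNontrivialZeros ↦ (Literature.NumberTheory.LFunctions.riemannZetaZeroOrder (z : ℂ) : ℝ)) i) ∧ (∀ i : ↥Literature.NumberTheory.LFunctions.ZetaZeros.riemannZetaNontrivialZeros, ((fun z : ↥Literature.NumberTheory.LFunctions.ZetaZeros.riemannZetaNontrivialZeros ↦ (z : ℂ)) i).re ≤ 1 / 2 → 0 ≤ ((fun z : ↥Literature.NumberTheory.LFunctions.ZetaZeros.riemannZetaNontrivialZeros ↦ (z : ℂ)) i).re) ∧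
      (∃ σ : ↥Literature.NumberTheory.LFunctions.ZetaZeros.riemannZetaNontrivialZeros → ↥Literature.NumberTheory.LFunctions.ZetaZeros.riemannZetaNontrivialZeros, ∀ i : ↥Literature.NumberTheory.LFunctions.ZetaZeros.riemannZetaNontrivialZeros, σ (σ i) = i ∧ (fun z : ↥Literature.NumberTheory.LFunctions.ZetaZeros.riemannZetaNontrivialZeros ↦ (z : ℂ)) (σ i) = (starRingEnd ℂ) ((fun z : ↥Literature.NumberTheory.LFunctions.ZetaZeros.riemannZetaNontrivialZeros ↦ (z : ℂ)) i) ∧ (fun z : ↥Literature.NumberTheory.LFunctions.ZetaZeros.riemannZetaNontrivialZeros ↦ (Literature.NumberTheory.LFunctions.riemannZetaZeroOrder (z : ℂ) : ℝ)) (σ i) = (fun z : ↥Literature.NumberTheory.LFunctions.ZetaZeros.riemannZetaNontrivialZeros ↦ (Literature.NumberTheory.LFunctions.riemannZetaZeroOrder (z : ℂ) : ℝ)) i)) := by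
  refine ⟨⟨⟨1, fun n ↦ ⟨ArithmeticFunction.vonMangoldt_nonneg, ?_⟩⟩, ?_⟩, ?_, ?_, ?_, ?_⟩
  · -- `Λ(n) ≤ log(n + 2)`
    beta_reduce
    rw [one_mul]
    refine ArithmeticFunction.vonMangoldt_le_log.trans ?_
    rcases Nat.eq_zero_or_pos n with hn | hn
    · subst hn; simp; exact Real.log_nonneg (by norm_num)
    · exact Real.log_le_log (by exact_mod_cast hn) (by linarith)
  · -- the window explicit formula
    intro φ hφ _hφ0 hφs
    obtain ⟨Cφ, hCφ⟩ := window_explicit_formula φ hφ hφs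
    exact ⟨Cφ, hCφ⟩
  · -- tame unit-window count
    obtain ⟨C, hC⟩ := exists_tame_window_bound
    exact ⟨C, hC⟩
  · -- `m(ρ) ≥ 0`
    intro i
    beta_reduce
    exact_mod_cast riemannZetaZeroOrder_nonneg (ZetaZeros.riemannZetaNontrivialZeros.ne_one i.2)
  · -- `Re ρ ≥ 0`
    intro i _
    exact (ZetaZeros.riemannZetaNontrivialZeros.re_pos i.2).le
  · -- the conjugation involution
    refine ⟨fun i ↦ ⟨conj (i : ℂ), ZetaZeros.riemannZetaNontrivialZeros.conj_mem i.2⟩,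
      fun i ↦ ⟨Subtype.ext (by simp), rfl, ?_⟩⟩
    beta_reduce
    exact_mod_cast riemannZetaZeroOrder_conj_holds (i : ℂ)

end Main

end Summit.RiemannHypothesis.RiemannHypothesis.Theorems.DensityLadderZetaIntegerPrimeConsistent

end
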